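import Literature.AlgebraicGeometry.Frobenioids.ModelFrobenioidComparisonFunctor
import Literature.AlgebraicGeometry.Frobenioids.DivisorialDescriptionsAPairs
import HarnessLib

/-!
# Frobenioids I, Theorem 5.2 (iv), proof step: the comparison functor is essentially surjective

Mochizuki, *The geometry of Frobenioids I: the general theory*, Kyushu J. Math. **62** (2008)
293–400, §5, proof of Theorem 5.2 (iv), kurims text p. 103 [cite: MochizukiFrdI2008, Thm. 5.2(iv)
p.103]:
"Moreover, this functor `C′ → [model]` is manifestly essentially surjective [cf. Theorem 5.1, (i)]".

Given a model object `(A_D, α)`: choose `A ∈ Ob(P)` with `b : Base A ≅ A_D` (the base-section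
`P → D` is essentially surjective), an `A`-pair `(ζ_A : B → A, ζ_X : B → X)` of pre-steps with class
`Φ(ζ_A)⁻¹(Div ζ_X − Div ζ_A) = Φ(b)(α)` exactly (seat L1-t10's `exists_apair_cls_eq`, from Def. 1.3
(iii)(d) — the surjectivity half of Thm. 5.1 (i)); co-angular by isotropy, this is an `F_P`-path for
`X`, and `(Base A, Φ(b)(α)) ≅ (A_D, α)` in the model Frobenioid by the base isomorphism `b` (degree
1,
trivial divisor and unit).  Valid for any unit datum `U`.
-/

namespace Literature.AlgebraicGeometry.Frobenioids

open CategoryTheory Opposite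

universe w v v' u u'

namespace PreFrobenioid

variable {D : Type u} [Category.{v} D] {Φ : Dᵒᵖ ⥤ CommMonCat.{w}}
  {C : Type u'} [Category.{v'} C] {F : C ⥤ ElemFrobenioid Φ} {hF : IsFrobenioid F}
  {hsq : HasBiratSquares F}

namespace FPPath

/-- An `A`-pair of pre-steps (seat L1-t5's `APair`) of a Frobenioid of isotropic type with `A ∈ P`
is an
`F_P`-path. [cite: MochizukiFrdI2008, Thm. 5.1(i) p.97] -/
def ofAPair (hiso : IsOfIsotropicType F) {P : Set C} {A : C} (hA : A ∈ P) (q : APair F A) :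
    FPPath F P q.tgt :=
  ⟨A, q.src, q.fst, q.snd, hA, isCoAngularPreStep_of_isotropic hiso q.isPreStep_fst,
    isCoAngularPreStep_of_isotropic hiso q.isPreStep_snd⟩

/-- The class of the path of an `A`-pair is the class of the `A`-pair (`Φ(ζ_A)⁻¹(Div ζ_X − Div
ζ_A)`).
[cite: MochizukiFrdI2008, Thm. 5.1(i) p.96] -/
theorem cls_ofAPair (hiso : IsOfIsotropicType F) {P : Set C} {A : C} (hA : A ∈ P) (q : APair F A) :
    cls (ofAPair hiso hA q) = q.cls := by
  haveI : IsIso (Base F q.fst) := q.isPreStep_fst.2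
  rw [cls_eq]
  change pullGp Φ (inv (Base F q.fst)) (Algebra.GrothendieckGroup.of (Div F q.snd) /
    Algebra.GrothendieckGroup.of (Div F q.fst)) = _
  rw [map_div, pullGp_of', pullGp_of']
  rfl

end FPPath

namespace UnitData

variable {P : Set C} {B : Dᵒᵖ ⥤ CommMonCat.{w}} {DivB : B ⟶ monoidGp Φ}

/-- A base isomorphism `b : Base A ≅ A_D` gives a model isomorphism `(Base A, Φ(b)(α)) ≅ (A_D, α)`
(degree `1`, trivial divisor and unit). [cite: MochizukiFrdI2008, Thm. 5.2(i) p.100] -/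
noncomputable def modelIsoOfBaseIso {A₀ A₁ : D} (b : A₁ ≅ A₀)
    (α : Algebra.GrothendieckGroup (Φ.obj (op A₀))) :
    (⟨A₁, pullGp Φ b.hom α⟩ : ModelFrobenioid Φ B DivB) ≅ ⟨A₀, α⟩ where
  hom :=
    { degFr := 1, base := b.hom, div := 1, unit := 1
      rel := by rw [PNat.one_coe, pow_one, map_one, mul_one, map_one, mul_one] }
  inv :=
    { degFr := 1, base := b.inv, div := 1, unit := 1
      rel := by
        rw [PNat.one_coe, pow_one, map_one, mul_one, map_one, mul_one, ← pullGp_comp,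
          Iso.inv_hom_id, pullGp_id] }
  hom_inv_id := by
    apply ModelFrobenioid.hom_ext
    · rfl
    · exact b.hom_inv_id
    · change (Φ.map b.hom.op).hom 1 * 1 ^ ((1 : ℕ+) : ℕ) = 1
      rw [map_one, one_pow, mul_one]
    · change (B.map b.hom.op).hom 1 * 1 ^ ((1 : ℕ+) : ℕ) = 1
      rw [map_one, one_pow, mul_one]
  inv_hom_id := by
    apply ModelFrobenioid.hom_ext
    · rfl
    · exact b.inv_hom_id
    · change (Φ.map b.inv.op).hom 1 * 1 ^ ((1 : ℕ+) : ℕ) = 1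
      rw [map_one, one_pow, mul_one]
    · change (B.map b.inv.op).hom 1 * 1 ^ ((1 : ℕ+) : ℕ) = 1
      rw [map_one, one_pow, mul_one]

/-- **The comparison functor is essentially surjective** (for the base-section `P` of a
base-Frobenius
pair of a Frobenioid of isotropic type; any unit datum). [cite: MochizukiFrdI2008, Thm. 5.2(iv)
p.103] -/
theorem comparison_essSurj (hiso : IsOfIsotropicType F) {P : Presection C} (hP : IsBaseSection F P)
    (U : UnitData hF hsq {A | P.obj A} B DivB) : (comparison U).EssSurj where
  mem_essImage Y := by
    haveI := hP.isEquivalence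
    obtain ⟨a, ⟨b⟩⟩ : (P.toBase F).essImage Y.base :=
      Functor.EssSurj.mem_essImage (F := P.toBase F) Y.base
    obtain ⟨q, hq⟩ := exists_apair_cls_eq F hF a.1 (pullGp Φ b.hom Y.cls)
    refine ⟨⟨q.tgt, FPPath.ofAPair hiso a.2 q⟩, ⟨?_⟩⟩
    change (⟨baseObj F a.1, FPPath.cls (FPPath.ofAPair hiso a.2 q)⟩ : ModelFrobenioid Φ B DivB) ≅ Y
    rw [FPPath.cls_ofAPair, hq]
    exact modelIsoOfBaseIso b Y.cls

end UnitData

end PreFrobenioid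

end Literature.AlgebraicGeometry.Frobenioids
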